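import Literature.AlgebraicGeometry.HyperbolicPolynomials.GardingInequality
import HarnessLib

/-!
# The extreme eigenvalues `λ_min`, `λ_max` of a hyperbolic polynomial; Gårding's concavity theorem

Topic `Literature/AlgebraicGeometry/HyperbolicPolynomials`. `HyperbolicityCone.lean` realises Renegar's
eigenvalues `λ₁(x), …, λ_d(x)` of `x` (the roots of `λ ↦ p(λe − x)`) as the multiset `eigenvalues p e x` and
phrases Renegar's definitions of the cones through "all eigenvalues are `≥ 0` / `> 0`". This file names the two
extreme eigenvalues and restates, literally, Renegar's

> The set `Λ₊₊ := {x : λ_min(x) > 0}` is the hyperbolicity cone […] `Λ₊ := {x : λ_min(x) ≥ 0}`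

(Renegar, Found. Comput. Math. 6 (2006), §2) and Gårding's concavity theorem in the form of
Bauschke–Güler–Lewis–Sendov (Canad. J. Math. 53 (2001)):

> **Theorem 2.5 (Gårding).** The largest characteristic root `λ₁(·)` is a sublinear function.
> [Proof: "Gårding showed that `λ_m` is concave (see [9, Theorem 2] and [8]), which is equivalent to the
> convexity of `λ₁`, since `λ₁(−x) = −λ_m(x)`."]

## Main results (namespace `Literature.AlgebraicGeometry.HyperbolicPolynomials`), for a form `p` of degree
`d ≥ 1` hyperbolic w.r.t. `e`

* `minEigenvalue p e x = λ_min(x)`, `maxEigenvalue p e x = λ_max(x)` (definitions with bodies: `sInf` / `sSup` of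
  the finite set of eigenvalues), `minEigenvalue_mem`, `minEigenvalue_le`, `le_minEigenvalue_iff`, and the
  `max` analogues; `maxEigenvalue_eq_neg_minEigenvalue_neg` (`λ_max(x) = −λ_min(−x)`).
* `mem_openHyperbolicityCone_iff_minEigenvalue_pos`, `mem_hyperbolicityCone_iff_minEigenvalue_nonneg` —
  Renegar's definitions of `Λ₊₊`, `Λ₊`, literally.
* `minEigenvalue_self` (`λ_min(e) = 1`), `minEigenvalue_add_smul_self` (`λ_min(x + te) = λ_min(x) + t`),
  `minEigenvalue_smul` (`λ_min(cx) = c λ_min(x)`, `c ≥ 0`), `minEigenvalue_add_ge`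
  (`λ_min(x + y) ≥ λ_min(x) + λ_min(y)`), **`concaveOn_minEigenvalue`** (Gårding: `λ_min` is concave on `ℝⁿ`),
  and dually `maxEigenvalue_smul`, `maxEigenvalue_add_le`, **`convexOn_maxEigenvalue`** (BGLS Thm 2.5: `λ_max`
  is sublinear).

## References

* [Renegar2006] J. Renegar, *Hyperbolic programs, and their derivative relaxations*, Found. Comput. Math. 6
  (2006) 59–79: §2 (eigenvalues, `λ_min`, `Λ₊₊ = {λ_min > 0}`, `Λ₊ = {λ_min ≥ 0}`).
* [BauschkeEtAl2001] H. H. Bauschke, O. Güler, A. S. Lewis, H. S. Sendov, *Hyperbolic polynomials and convex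
  analysis*, Canad. J. Math. 53 (2001) 470–488: Thm. 2.5 and its proof, Fact 2.7.
* [Garding1959] L. Gårding, *An inequality for hyperbolic polynomials*, J. Math. Mech. 8 (1959) 957–965,
  Thm. 2 (`λ_m` is concave).
-/

noncomputable section

open MvPolynomial

namespace Literature.AlgebraicGeometry.HyperbolicPolynomials

variable {σ : Type*}

/-- **`λ_min(x)`**, the least eigenvalue of `x` with respect to the form `p` in direction `e` (Renegar:
"`λ_min(x)`"), as the infimum of the (finite) set of eigenvalues. [cite: Renegar2006, §2] -/
def minEigenvalue (f : MvPolynomial σ ℝ) (e x : σ → ℝ) : ℝ :=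
  sInf {lam | lam ∈ eigenvalues f e x}

/-- **`λ_max(x)`**, the largest eigenvalue of `x` (Bauschke–Güler–Lewis–Sendov: "the largest
characteristic root `λ₁(x)`"), as the supremum of the set of eigenvalues. [cite: BauschkeEtAl2001, §2
(before Thm. 2.5)] -/
def maxEigenvalue (f : MvPolynomial σ ℝ) (e x : σ → ℝ) : ℝ :=
  sSup {lam | lam ∈ eigenvalues f e x}

variable {f : MvPolynomial σ ℝ} {d : ℕ} {e : σ → ℝ}

/-! ## §1 The extreme eigenvalues are eigenvalues -/

section Basic

/-- A form of positive degree has at least one eigenvalue at every point. [cite: Renegar2006, §2] -/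
theorem eigenvalues_nonempty (hf : f.IsHomogeneous d) (he : IsHyperbolic f e) (hd : 0 < d) (x : σ → ℝ) :
    {lam | lam ∈ eigenvalues f e x}.Nonempty := by
  have h : 0 < Multiset.card (eigenvalues f e x) := by rw [card_eigenvalues hf he x]; exact hd
  obtain ⟨lam, hlam⟩ := Multiset.card_pos_iff_exists_mem.1 h
  exact ⟨lam, hlam⟩

/-- `λ_min(x)` is an eigenvalue of `x`. [cite: Renegar2006, §2] -/
theorem minEigenvalue_mem (hf : f.IsHomogeneous d) (he : IsHyperbolic f e) (hd : 0 < d) (x : σ → ℝ) :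
    minEigenvalue f e x ∈ eigenvalues f e x :=
  (eigenvalues_nonempty hf he hd x).csInf_mem (Multiset.finite_toSet _)

/-- `λ_min(x) ≤ λ` for every eigenvalue `λ` of `x`. [cite: Renegar2006, §2] -/
theorem minEigenvalue_le {x : σ → ℝ} {lam : ℝ} (hlam : lam ∈ eigenvalues f e x) :
    minEigenvalue f e x ≤ lam :=
  csInf_le (Multiset.finite_toSet _).bddBelow hlam

/-- `a ≤ λ_min(x)` iff `a` is a lower bound for the eigenvalues of `x`. [cite: Renegar2006, §2] -/
theorem le_minEigenvalue_iff (hf : f.IsHomogeneous d) (he : IsHyperbolic f e) (hd : 0 < d) {x : σ → ℝ}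
    {a : ℝ} : a ≤ minEigenvalue f e x ↔ ∀ lam ∈ eigenvalues f e x, a ≤ lam :=
  ⟨fun h _ hlam => h.trans (minEigenvalue_le hlam), fun h => h _ (minEigenvalue_mem hf he hd x)⟩

/-- `a < λ_min(x)` iff `a < λ` for every eigenvalue `λ` of `x`. [cite: Renegar2006, §2] -/
theorem lt_minEigenvalue_iff (hf : f.IsHomogeneous d) (he : IsHyperbolic f e) (hd : 0 < d) {x : σ → ℝ}
    {a : ℝ} : a < minEigenvalue f e x ↔ ∀ lam ∈ eigenvalues f e x, a < lam :=
  ⟨fun h _ hlam => h.trans_le (minEigenvalue_le hlam), fun h => h _ (minEigenvalue_mem hf he hd x)⟩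

/-- `λ_max(x)` is an eigenvalue of `x`. [cite: BauschkeEtAl2001, §2] -/
theorem maxEigenvalue_mem (hf : f.IsHomogeneous d) (he : IsHyperbolic f e) (hd : 0 < d) (x : σ → ℝ) :
    maxEigenvalue f e x ∈ eigenvalues f e x :=
  (eigenvalues_nonempty hf he hd x).csSup_mem (Multiset.finite_toSet _)

/-- `λ ≤ λ_max(x)` for every eigenvalue `λ` of `x`. [cite: BauschkeEtAl2001, §2] -/
theorem le_maxEigenvalue {x : σ → ℝ} {lam : ℝ} (hlam : lam ∈ eigenvalues f e x) :
    lam ≤ maxEigenvalue f e x :=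
  le_csSup (Multiset.finite_toSet _).bddAbove hlam

/-- `λ_max(x) ≤ a` iff `a` is an upper bound for the eigenvalues of `x`. [cite: BauschkeEtAl2001, §2] -/
theorem maxEigenvalue_le_iff (hf : f.IsHomogeneous d) (he : IsHyperbolic f e) (hd : 0 < d) {x : σ → ℝ}
    {a : ℝ} : maxEigenvalue f e x ≤ a ↔ ∀ lam ∈ eigenvalues f e x, lam ≤ a :=
  ⟨fun h _ hlam => (le_maxEigenvalue hlam).trans h, fun h => h _ (maxEigenvalue_mem hf he hd x)⟩

/-- `λ_min(x) ≤ λ_max(x)`. [cite: Renegar2006, §2] -/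
theorem minEigenvalue_le_maxEigenvalue (hf : f.IsHomogeneous d) (he : IsHyperbolic f e) (hd : 0 < d)
    (x : σ → ℝ) : minEigenvalue f e x ≤ maxEigenvalue f e x :=
  minEigenvalue_le (maxEigenvalue_mem hf he hd x)

end Basic

/-! ## §2 Renegar's definitions of the cones, literally -/

section Cones

/-- **Renegar: "The set `Λ₊₊ := {x : λ_min(x) > 0}` is the hyperbolicity cone."**
[cite: Renegar2006, §2 (definition of Λ₊₊)] -/
theorem mem_openHyperbolicityCone_iff_minEigenvalue_pos (hf : f.IsHomogeneous d) (he : IsHyperbolic f e)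
    (hd : 0 < d) (x : σ → ℝ) : x ∈ openHyperbolicityCone f e ↔ 0 < minEigenvalue f e x := by
  rw [mem_openHyperbolicityCone_iff_eigenvalues_pos hf he, lt_minEigenvalue_iff hf he hd]

/-- **Renegar: "`Λ₊ := {x : λ_min(x) ≥ 0}`."** [cite: Renegar2006, §2 (definition of Λ₊)] -/
theorem mem_hyperbolicityCone_iff_minEigenvalue_nonneg (hf : f.IsHomogeneous d) (he : IsHyperbolic f e)
    (hd : 0 < d) (x : σ → ℝ) : x ∈ hyperbolicityCone f e ↔ 0 ≤ minEigenvalue f e x := by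
  rw [mem_hyperbolicityCone_iff_eigenvalues_nonneg hf he, le_minEigenvalue_iff hf he hd]

/-- On the open cone `p(x)` has the sign of `p(e)`, quantitatively: `p(x)/p(e) ≥ λ_min(x)^d`.
[cite: Renegar2006, §2 (`p(x) = p(e) ∏ λⱼ(x)`)] -/
theorem minEigenvalue_pow_le_eval_div_eval (hf : f.IsHomogeneous d) (he : IsHyperbolic f e) {x : σ → ℝ}
    (hx : x ∈ hyperbolicityCone f e) :
    minEigenvalue f e x ^ d ≤ MvPolynomial.eval x f / MvPolynomial.eval e f := by
  rcases Nat.eq_zero_or_pos d with hd | hd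
  · subst hd
    have h := eval_div_eval_eq_prod_eigenvalues hf he x
    rw [Multiset.card_eq_zero.1 (card_eigenvalues hf he x), Multiset.prod_zero] at h
    rw [pow_zero, h]
  rw [eval_div_eval_eq_prod_eigenvalues hf he x]
  have hnn : 0 ≤ minEigenvalue f e x := (mem_hyperbolicityCone_iff_minEigenvalue_nonneg hf he hd x).1 hx
  calc minEigenvalue f e x ^ d = ((eigenvalues f e x).map fun _ => minEigenvalue f e x).prod := by
        rw [Multiset.map_const', Multiset.prod_replicate, card_eigenvalues hf he]
    _ ≤ ((eigenvalues f e x).map id).prod :=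
        Multiset.prod_map_le_prod_map₀ _ _ (fun _ _ => hnn) fun lam hlam => minEigenvalue_le hlam
    _ = (eigenvalues f e x).prod := by rw [Multiset.map_id]

end Cones

/-! ## §3 Calculus of `λ_min`: normalisation, translation, homogeneity, superadditivity -/

section MinCalc

/-- `λ_min(e) = 1` (the only eigenvalue of `e` is `1`: `p(e − λe) = (1 − λ)^d p(e)`). [cite: Renegar2006, §2] -/
theorem minEigenvalue_self (hf : f.IsHomogeneous d) (he : IsHyperbolic f e) (hd : 0 < d) :
    minEigenvalue f e e = 1 := by
  have hmem : ∀ lam ∈ eigenvalues f e e, lam = 1 := by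
    intro lam hlam
    rw [mem_eigenvalues_iff hf he.eval_ne_zero] at hlam
    have h1 : e - lam • e = (1 - lam) • e := by rw [sub_smul, one_smul]
    rw [h1, hf.eval_smul_eq] at hlam
    rcases mul_eq_zero.1 hlam with h | h
    · have := pow_eq_zero_iff (n := d) (by omega) |>.1 h
      linarith
    · exact absurd h he.eval_ne_zero
  exact hmem _ (minEigenvalue_mem hf he hd e)

/-- **Translation along the direction**: `λ_min(x + te) = λ_min(x) + t` (the eigenvalues shift by `t`).
[cite: Renegar2006, §2] -/
theorem minEigenvalue_add_smul_self (hf : f.IsHomogeneous d) (he : IsHyperbolic f e) (hd : 0 < d)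
    (x : σ → ℝ) (t : ℝ) : minEigenvalue f e (x + t • e) = minEigenvalue f e x + t := by
  refine eq_of_forall_le_iff fun a => ?_
  rw [le_minEigenvalue_iff hf he hd, ← sub_le_iff_le_add, le_minEigenvalue_iff hf he hd]
  have hx : x = (x + t • e) - t • e := by rw [add_sub_cancel_right]
  constructor
  · intro h lam hlam
    have hmem : lam + t ∈ eigenvalues f e (x + t • e) := by
      rw [hx, mem_eigenvalues_sub_smul_iff hf he.eval_ne_zero] at hlam
      exact hlam
    linarith [h _ hmem]
  · intro h lam hlam
    have hmem : lam - t ∈ eigenvalues f e x := by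
      rw [hx, mem_eigenvalues_sub_smul_iff hf he.eval_ne_zero, sub_add_cancel]
      exact hlam
    linarith [h _ hmem]

/-- The eigenvalues of `0` are all `0`, so `λ_min(0) = 0`. [cite: Renegar2006, §2] -/
theorem minEigenvalue_zero (hf : f.IsHomogeneous d) (he : IsHyperbolic f e) (hd : 0 < d) :
    minEigenvalue f e 0 = 0 := by
  have hmem : ∀ lam ∈ eigenvalues f e (0 : σ → ℝ), lam = 0 := by
    intro lam hlam
    rw [mem_eigenvalues_iff hf he.eval_ne_zero, zero_sub, ← neg_smul, hf.eval_smul_eq] at hlam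
    rcases mul_eq_zero.1 hlam with h | h
    · have := pow_eq_zero_iff (n := d) (by omega) |>.1 h
      linarith
    · exact absurd h he.eval_ne_zero
  exact hmem _ (minEigenvalue_mem hf he hd 0)

/-- **Positive homogeneity**: `λ_min(cx) = c λ_min(x)` for `c ≥ 0` (Bauschke–Güler–Lewis–Sendov, Fact 2.4:
"`λ(tx) = tλ(x)`"). [cite: BauschkeEtAl2001, Fact 2.4] -/
theorem minEigenvalue_smul (hf : f.IsHomogeneous d) (he : IsHyperbolic f e) (hd : 0 < d) (x : σ → ℝ)
    {c : ℝ} (hc : 0 ≤ c) : minEigenvalue f e (c • x) = c * minEigenvalue f e x := by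
  rcases hc.eq_or_lt with rfl | hc'
  · rw [zero_smul, zero_mul, minEigenvalue_zero hf he hd]
  refine le_antisymm ?_ ?_
  · -- apply the scaling bound to `c • x` and `c⁻¹`
    have h := eigenvalues_smul_ge hf he (inv_pos.2 hc')
      ((le_minEigenvalue_iff hf he hd).1 (le_refl (minEigenvalue f e (c • x))))
    rw [smul_smul, inv_mul_cancel₀ hc'.ne', one_smul] at h
    have h2 := (le_minEigenvalue_iff hf he hd).2 h
    rwa [← div_eq_inv_mul, div_le_iff₀ hc', mul_comm] at h2
  · exact (le_minEigenvalue_iff hf he hd).2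
      (eigenvalues_smul_ge hf he hc' ((le_minEigenvalue_iff hf he hd).1 le_rfl))

/-- **Superadditivity (Gårding)**: `λ_min(x + y) ≥ λ_min(x) + λ_min(y)`. [cite: BauschkeEtAl2001, Thm. 2.5]
[cite: Garding1959, Thm 2] -/
theorem minEigenvalue_add_ge (hf : f.IsHomogeneous d) (he : IsHyperbolic f e) (hd : 0 < d) (x y : σ → ℝ) :
    minEigenvalue f e x + minEigenvalue f e y ≤ minEigenvalue f e (x + y) :=
  (le_minEigenvalue_iff hf he hd).2 (eigenvalues_add_ge hf he
    ((le_minEigenvalue_iff hf he hd).1 le_rfl) ((le_minEigenvalue_iff hf he hd).1 le_rfl))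

/-- **Gårding's theorem: `λ_min` is concave on all of `ℝⁿ`** ("Gårding showed that `λ_m` is concave").
[cite: BauschkeEtAl2001, Thm. 2.5 (proof)] [cite: Garding1959, Thm 2] -/
theorem concaveOn_minEigenvalue (hf : f.IsHomogeneous d) (he : IsHyperbolic f e) (hd : 0 < d) :
    ConcaveOn ℝ Set.univ (minEigenvalue f e) := by
  refine ⟨convex_univ, fun x _ y _ a b ha hb _ => ?_⟩
  calc a • minEigenvalue f e x + b • minEigenvalue f e y
      = minEigenvalue f e (a • x) + minEigenvalue f e (b • y) := by
        rw [smul_eq_mul, smul_eq_mul, minEigenvalue_smul hf he hd x ha, minEigenvalue_smul hf he hd y hb]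
    _ ≤ minEigenvalue f e (a • x + b • y) := minEigenvalue_add_ge hf he hd _ _

end MinCalc

/-! ## §4 `λ_max(x) = −λ_min(−x)` and the sublinearity of `λ_max` -/

section MaxCalc

/-- The eigenvalues of `−x` are the negatives of those of `x` (`p(−x − λe) = (−1)^d p(x − (−λ)e)`).
[cite: BauschkeEtAl2001, §2 (proof of Thm. 2.5: `λ₁(−x) = −λ_m(x)`)] -/
theorem mem_eigenvalues_neg_iff (hf : f.IsHomogeneous d) (he : IsHyperbolic f e) (x : σ → ℝ) (lam : ℝ) :
    lam ∈ eigenvalues f e (-x) ↔ -lam ∈ eigenvalues f e x := by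
  rw [mem_eigenvalues_iff hf he.eval_ne_zero, mem_eigenvalues_iff hf he.eval_ne_zero]
  have h1 : -x - lam • e = (-1 : ℝ) • (x - (-lam) • e) := by
    ext i
    simp only [Pi.sub_apply, Pi.neg_apply, Pi.smul_apply, smul_eq_mul]
    ring
  rw [h1, hf.eval_smul_eq]
  exact ⟨fun h => (mul_eq_zero.1 h).resolve_left (pow_ne_zero d (by norm_num)), fun h => by rw [h, mul_zero]⟩

/-- **`λ_max(x) = −λ_min(−x)`** ("`λ₁(−x) = −λ_m(x)`"). [cite: BauschkeEtAl2001, §2 (proof of Thm. 2.5)] -/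
theorem maxEigenvalue_eq_neg_minEigenvalue_neg (hf : f.IsHomogeneous d) (he : IsHyperbolic f e)
    (hd : 0 < d) (x : σ → ℝ) : maxEigenvalue f e x = -minEigenvalue f e (-x) := by
  refine eq_of_forall_ge_iff fun a => ?_
  rw [maxEigenvalue_le_iff hf he hd, neg_le, le_minEigenvalue_iff hf he hd]
  constructor
  · intro h lam hlam
    have := h _ ((mem_eigenvalues_neg_iff hf he x lam).1 hlam)
    linarith
  · intro h lam hlam
    have := h (-lam) ((mem_eigenvalues_neg_iff hf he x (-lam)).2 (by rwa [neg_neg]))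
    linarith

/-- `λ_max(e) = 1`. [cite: BauschkeEtAl2001, §2] -/
theorem maxEigenvalue_self (hf : f.IsHomogeneous d) (he : IsHyperbolic f e) (hd : 0 < d) :
    maxEigenvalue f e e = 1 :=
  le_antisymm ((maxEigenvalue_le_iff hf he hd).2 fun lam hlam => by
      have := minEigenvalue_self hf he hd
      -- all eigenvalues of `e` equal `1`
      rw [mem_eigenvalues_iff hf he.eval_ne_zero] at hlam
      have h1 : e - lam • e = (1 - lam) • e := by rw [sub_smul, one_smul]
      rw [h1, hf.eval_smul_eq] at hlam
      rcases mul_eq_zero.1 hlam with h | h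
      · have := pow_eq_zero_iff (n := d) (by omega) |>.1 h
        linarith
      · exact absurd h he.eval_ne_zero)
    (by rw [← minEigenvalue_self hf he hd]; exact minEigenvalue_le_maxEigenvalue hf he hd e)

/-- **Positive homogeneity of `λ_max`**: `λ_max(cx) = c λ_max(x)` for `c ≥ 0`. [cite: BauschkeEtAl2001,
Fact 2.4 and Thm. 2.5] -/
theorem maxEigenvalue_smul (hf : f.IsHomogeneous d) (he : IsHyperbolic f e) (hd : 0 < d) (x : σ → ℝ)
    {c : ℝ} (hc : 0 ≤ c) : maxEigenvalue f e (c • x) = c * maxEigenvalue f e x := by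
  rw [maxEigenvalue_eq_neg_minEigenvalue_neg hf he hd, maxEigenvalue_eq_neg_minEigenvalue_neg hf he hd,
    ← smul_neg, minEigenvalue_smul hf he hd _ hc, mul_neg]

/-- **Subadditivity of `λ_max`**: `λ_max(x + y) ≤ λ_max(x) + λ_max(y)`. [cite: BauschkeEtAl2001, Thm. 2.5] -/
theorem maxEigenvalue_add_le (hf : f.IsHomogeneous d) (he : IsHyperbolic f e) (hd : 0 < d) (x y : σ → ℝ) :
    maxEigenvalue f e (x + y) ≤ maxEigenvalue f e x + maxEigenvalue f e y := by
  rw [maxEigenvalue_eq_neg_minEigenvalue_neg hf he hd, maxEigenvalue_eq_neg_minEigenvalue_neg hf he hd x,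
    maxEigenvalue_eq_neg_minEigenvalue_neg hf he hd y, neg_add]
  have := minEigenvalue_add_ge hf he hd (-x) (-y)
  linarith

/-- **Bauschke–Güler–Lewis–Sendov, Theorem 2.5 (Gårding): "The largest characteristic root `λ₁(·)` is a
sublinear function"** — here: `λ_max` is convex on `ℝⁿ` (positive homogeneity is `maxEigenvalue_smul`).
[cite: BauschkeEtAl2001, Thm. 2.5] [cite: Garding1959, Thm 2] -/
theorem convexOn_maxEigenvalue (hf : f.IsHomogeneous d) (he : IsHyperbolic f e) (hd : 0 < d) :
    ConvexOn ℝ Set.univ (maxEigenvalue f e) := by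
  refine ⟨convex_univ, fun x _ y _ a b ha hb _ => ?_⟩
  calc maxEigenvalue f e (a • x + b • y)
      ≤ maxEigenvalue f e (a • x) + maxEigenvalue f e (b • y) := maxEigenvalue_add_le hf he hd _ _
    _ = a • maxEigenvalue f e x + b • maxEigenvalue f e y := by
        rw [smul_eq_mul, smul_eq_mul, maxEigenvalue_smul hf he hd x ha, maxEigenvalue_smul hf he hd y hb]

end MaxCalc

end Literature.AlgebraicGeometry.HyperbolicPolynomials
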